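import Summits.Ventures.PercRepro.RankLevelSetRuleQCellFourSliceTwo

/-!
# PercRepro — RULE Q IS EXACTLY THE `k ≤ 4` MECHANISM: (R̂) FAILS ON THE CELL `(q+5, q)` FOR EVERY `q ≥ 1002`
(night-1, gen 16; dossier §27.6)

On every cell family `k ≥ 5` the inequality (R̂) of RankLevelSetRuleQRhat — hence Rule Q's equal split — fails from some
`q` on: at a fixed truncated slice `u = q − m ≤ k − 3`, `R̂(q, k, q−u)/Φ(q+k, q) → (u+k)/(2(k−1)) < 1` (`S₁ → 1/2`, every
other slice sum and the truncation gain vanish, `Φ → k − 1`). Exact first failures (own rationals, mining/night-1/g16/):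
`k = 5`: the cell `(677, 672)`, `m = 670` (R̂/Φ = 0.99999331); `k = 6`: `(270, 264)`, `m = 261`; `k = 7`: `(148, 141)`, `m = 138`.
This module puts the `k = 5` family in the kernel for every `q ≥ 1002` (`q = m + 2`, `m ≥ 1000`), where crude bounds suffice:
* `R̂(m+2, 5, m) ≤ 7S₁ + 21S₂ + (35/2)·T` — the truncated `m̂(q, m; a, 3) ≥ 3C(q+a, a+2)`, `m̂(q, m; a, 4) ≥ 6C(q+a, a+2)`
  (`mhat_three_ge`, `mhat_four_ge`), `T := Σ_{a≤m} C(m, a)/C(m+2+a, a+2)`;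
* on the symmetric rows `2m + 2` and `2m` the partial sums are EXACT (`sum_range_choose_half_two`, `sum_range_choose_half_zero`),
  so with `X := 4^m/C(2m, m)`: `S₁ = ((m+1) − ρ)/(2m+3)`, `S₂ = (1 + 2ρ)/(2(2m+3))`, `ρ = X(m+2)/(2m+1) − 1 − (m+2)/(2(m+1))`,
  `T = 1/(2m+2) + X/(2(2m+1))` (`slice_sum_one_eq` at `q = m`, `cellTwo_sum_eq`, `slice_two_S2_eq`) — a bound LINEAR in `X`
  with positive coefficient;
* the Wallis UPPER bound `16^k ≤ C(2k, k)²·4k` (`centralBinom_sq_mul_ge`) gives `X ≤ 2√m`, and the certificate (degree 10 in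
  `t = m − 1000`, 11 positive coefficients) closes `base + c·X < Φ(m+7, m+2) = 4(m+7)(m+5)/((m+3)(m+4))` (`phiK_five`).
* **`rhat_five_lt_phiK`** — `R̂(m+2, 5, m) < Φ(m+7, m+2)` for every `m ≥ 1000`; **`not_rhatCell_five`** — `¬ RhatCell q 5` for every
  `q ≥ 1002`. With p4's `rhatCell_two` / `rhatCell_three` / `rhatCell_four`, (R̂) holds on every cell of exactly the families
  `k ≤ 4`. Twin: mining/night-1/g16/k5neg.py (the bound chain exact for `m < 30`, the certificate from `m = 918`), k5exact.py
  (the exact first failure `q = 672`). Axioms: standard.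
-/

namespace PercRepro

open Finset

/-! ### §1 The even half row and the other Wallis bound -/

/-- **The half row, even case**: `2·Σ_{i<m} C(2m, i) + C(2m, m) = 4^m`. -/
lemma sum_range_choose_half_zero (m : ℕ) :
    2 * ∑ i ∈ range m, (2 * m).choose i + (2 * m).choose m = 4 ^ m := by
  have hrow := Nat.sum_range_choose (2 * m)
  rw [show 2 * m + 1 = (m + 1) + m by ring, Finset.sum_range_add] at hrow
  have hrefl : ∑ i ∈ range m, (2 * m).choose (m + 1 + i) = ∑ i ∈ range m, (2 * m).choose i := by
    rw [← Finset.sum_range_reflect (fun i => (2 * m).choose i) m]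
    refine Finset.sum_congr rfl (fun i hi => ?_)
    rw [Finset.mem_range] at hi
    exact Nat.choose_symm_of_eq_add (by omega)
  rw [hrefl, Finset.sum_range_succ] at hrow
  rw [show (4 : ℕ) ^ m = 2 ^ (2 * m) by rw [pow_mul]; norm_num]
  omega

/-- **Wallis, upper bound**: `16^k ≤ (centralBinom k)² · 4k` for `k ≥ 1` (equality at `k = 1`; the step is
`4k(2k+1)² ≥ 4k·4k(k+1)`, i.e. `(2k+1)² ≥ 4k(k+1)`). -/
lemma centralBinom_sq_mul_ge : ∀ k : ℕ, 1 ≤ k → 16 ^ k ≤ k.centralBinom ^ 2 * (4 * k) := by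
  intro k
  induction k with
  | zero => intro h; omega
  | succ k ih =>
    intro _
    rcases Nat.eq_zero_or_pos k with hk0 | hkpos
    · subst hk0
      decide
    · have ih' := ih hkpos
      have hrec := Nat.succ_mul_centralBinom_succ k
      have h1 : (k + 1) ^ 2 * ((k + 1).centralBinom ^ 2 * (4 * (k + 1)))
          = 4 * (2 * k + 1) ^ 2 * (k + 1) * (k.centralBinom ^ 2 * 4) := by
        have : ((k + 1) * (k + 1).centralBinom) ^ 2 = (2 * (2 * k + 1) * k.centralBinom) ^ 2 := by rw [hrec]
        nlinarith [this]
      have h2 : (k + 1) ^ 2 * 16 ^ (k + 1) ≤ (k + 1) ^ 2 * ((k + 1).centralBinom ^ 2 * (4 * (k + 1))) := by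
        rw [h1]
        calc (k + 1) ^ 2 * 16 ^ (k + 1) = 16 * (k + 1) ^ 2 * 16 ^ k := by ring
          _ ≤ 16 * (k + 1) ^ 2 * (k.centralBinom ^ 2 * (4 * k)) := Nat.mul_le_mul_left _ ih'
          _ = (4 * k * (k + 1)) * (16 * (k + 1) * k.centralBinom ^ 2) := by ring
          _ ≤ ((2 * k + 1) ^ 2) * (16 * (k + 1) * k.centralBinom ^ 2) := by
              apply Nat.mul_le_mul_right
              nlinarith
          _ = 4 * (2 * k + 1) ^ 2 * (k + 1) * (k.centralBinom ^ 2 * 4) := by ring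
      exact Nat.le_of_mul_le_mul_left h2 (by positivity)

/-! ### §2 The slice sums in closed form on the symmetric rows -/

/-- **`S₁` in closed form, any `q`**: `Σ_{a ≤ m} C(m, a)/C(q+1+a, a+1) = ((m+1)·C − (q−m−1)·P)/(C·(q+m+1))`,
`C = C(q+m, m)`, `P = Σ_{i<m} C(q+m, i)` (RankLevelSetRuleQCellTwo's identities; `cellTwo_sum_eq` is the case `q = m+v+1`). -/
lemma slice_sum_one_eq (q m : ℕ) :
    ∑ a ∈ range (m + 1), (m.choose a : ℚ) / ((q + 1 + a).choose (a + 1) : ℚ)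
      = (((m : ℚ) + 1) * ((q + m).choose m : ℚ) - ((q : ℚ) - m - 1) * ∑ i ∈ range m, ((q + m).choose i : ℚ))
        / (((q + m).choose m : ℚ) * ((q : ℚ) + m + 1)) := by
  have hsplit : ∑ a ∈ range (m + 1), (m.choose a : ℚ) / ((q + 1 + a).choose (a + 1) : ℚ)
      = ∑ a ∈ range (m + 1), (m.choose a : ℚ) / ((q + a).choose a : ℚ)
        - (q : ℚ) / ((q : ℚ) + 1) * ∑ a ∈ range (m + 1), (m.choose a : ℚ) / ((q + 1 + a).choose a : ℚ) := by
    rw [Finset.mul_sum, ← Finset.sum_sub_distrib]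
    refine Finset.sum_congr rfl (fun a _ => ?_)
    have h := one_div_choose_succ_eq q a
    calc (m.choose a : ℚ) / ((q + 1 + a).choose (a + 1) : ℚ)
        = (m.choose a : ℚ) * (1 / ((q + 1 + a).choose (a + 1) : ℚ)) := by ring
      _ = (m.choose a : ℚ) * (1 / ((q + a).choose a : ℚ)
            - (q : ℚ) / ((q : ℚ) + 1) * (1 / ((q + 1 + a).choose a : ℚ))) := by rw [h]
      _ = _ := by ring
  rw [hsplit, sum_choose_div_choose_eq, sum_choose_div_choose_eq]
  have hP := sum_choose_succ_eq (q + m) m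
  rw [Finset.sum_range_succ (fun i => (q + m).choose i) m] at hP
  rw [show q + 1 + m = q + m + 1 by ring]
  rw [Finset.sum_range_succ (fun i => ((q + m).choose i : ℚ)) m]
  have hPsum : (∑ i ∈ range (m + 1), ((q + m + 1).choose i : ℚ))
      = 2 * (∑ i ∈ range m, ((q + m).choose i : ℚ)) + ((q + m).choose m : ℚ) := by
    have h' : ((∑ i ∈ range (m + 1), (q + m + 1).choose i : ℕ) : ℚ)
        = ((∑ i ∈ range m, (q + m).choose i + (q + m).choose m + ∑ i ∈ range m, (q + m).choose i : ℕ) : ℚ) := by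
      rw [hP]
    push_cast at h'
    rw [h']; ring
  rw [hPsum]
  set C := ((q + m).choose m : ℚ) with hC
  set D := ((q + m + 1).choose m : ℚ) with hD
  set P := ∑ i ∈ range m, ((q + m).choose i : ℚ) with hPdef
  have hDC : D * ((q : ℚ) + 1) = C * ((q : ℚ) + m + 1) := by
    have h := Nat.choose_mul_succ_eq (q + m) m
    rw [show q + m + 1 - m = q + 1 by omega] at h
    have h' : C * ((q : ℚ) + m + 1) = D * ((q : ℚ) + 1) := by rw [hC, hD]; exact_mod_cast h
    linarith [h']
  have hCpos : (0 : ℚ) < C := by rw [hC]; exact_mod_cast Nat.choose_pos (by omega)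
  have hDval : D = C * ((q : ℚ) + m + 1) / ((q : ℚ) + 1) := by rw [eq_div_iff (by positivity)]; exact hDC
  rw [hDval]
  field_simp
  ring

/-- **`T = Σ_{a ≤ m} C(m, a)/C(m+2+a, a+2)` in closed form**: `T = 1/(2m+2) + X/(2(2m+1))`, `X = 4^m/C(2m, m)` — the
termwise identity, `S₁` at `q = m` (the even half row makes `P` exact) and `S₁(m+1, m) = 1/2`. -/
lemma slice_T_eq (m : ℕ) (hm : 1 ≤ m) :
    ∑ a ∈ range (m + 1), (m.choose a : ℚ) / ((m + 2 + a).choose (a + 2) : ℚ)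
      = 1 / (2 * (m : ℚ) + 2) + ((4 : ℚ) ^ m / ((2 * m).choose m : ℚ)) / (2 * (2 * (m : ℚ) + 1)) := by
  have hsplit : ∑ a ∈ range (m + 1), (m.choose a : ℚ) / ((m + 2 + a).choose (a + 2) : ℚ)
      = ∑ a ∈ range (m + 1), (m.choose a : ℚ) / ((m + 1 + a).choose (a + 1) : ℚ)
        - (m : ℚ) / ((m : ℚ) + 1) * ∑ a ∈ range (m + 1), (m.choose a : ℚ) / ((m + 0 + 1 + 1 + a).choose (a + 1) : ℚ) := by
    rw [Finset.mul_sum, ← Finset.sum_sub_distrib]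
    refine Finset.sum_congr rfl (fun a _ => ?_)
    have h := one_div_choose_succ_eq m (a + 1)
    rw [show m + 1 + (a + 1) = m + 2 + a by ring, show m + (a + 1) = m + 1 + a by ring] at h
    have h' : (1 : ℚ) / ((m + 2 + a).choose (a + 2) : ℚ)
        = 1 / ((m + 1 + a).choose (a + 1) : ℚ)
          - (m : ℚ) / ((m : ℚ) + 1) * (1 / ((m + 0 + 1 + 1 + a).choose (a + 1) : ℚ)) := by
      rw [show a + 2 = a + 1 + 1 by ring, show m + 0 + 1 + 1 + a = m + 2 + a by ring]; exact h
    calc (m.choose a : ℚ) / ((m + 2 + a).choose (a + 2) : ℚ)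
        = (m.choose a : ℚ) * (1 / ((m + 2 + a).choose (a + 2) : ℚ)) := by ring
      _ = (m.choose a : ℚ) * (1 / ((m + 1 + a).choose (a + 1) : ℚ)
          - (m : ℚ) / ((m : ℚ) + 1) * (1 / ((m + 0 + 1 + 1 + a).choose (a + 1) : ℚ))) := by rw [h']
      _ = _ := by ring
  rw [hsplit, slice_sum_one_eq m m, cellTwo_sum_eq m 0]
  push_cast
  have hhalf := sum_range_choose_half_zero m
  have hh : ((2 * ∑ i ∈ range m, (2 * m).choose i + (2 * m).choose m : ℕ) : ℚ) = ((4 ^ m : ℕ) : ℚ) := by rw [hhalf]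
  push_cast at hh
  rw [show m + m = 2 * m by ring]
  set C := ((2 * m).choose m : ℚ) with hC
  set P := ∑ i ∈ range m, ((2 * m).choose i : ℚ) with hPdef
  have hCpos : (0 : ℚ) < C := by rw [hC]; exact_mod_cast Nat.choose_pos (by omega)
  have hC1pos : (0 : ℚ) < ((m + 0 + 1 + m).choose m : ℚ) := by exact_mod_cast Nat.choose_pos (by omega)
  have hPval : P = ((4 : ℚ) ^ m - C) / 2 := by rw [eq_div_iff (by norm_num)]; linarith [hh]
  rw [hPval]
  field_simp
  ring

/-! ### §3 `Φ(q+5, q)` and the truncated `m̂` at `u = 2` -/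

/-- `Φ(q+5, q) = 4(q+5)(q+3)/((q+1)(q+2))`. -/
lemma phiK_five (q : ℕ) : phiK (q + 5) q = 4 * ((q : ℚ) + 5) * ((q : ℚ) + 3) / (((q : ℚ) + 1) * ((q : ℚ) + 2)) := by
  rw [phiK_eq_sum_range q 5 (by omega)]
  simp only [show (5 : ℕ) - 1 = 4 by rfl, Finset.sum_range_succ, Finset.sum_range_zero, zero_add,
    Nat.choose_one_right, add_zero]
  have h1 : (q + 0 + 1).choose q = q + 1 := by
    rw [show q + 0 + 1 = q + 1 by ring, Nat.choose_symm_add, Nat.choose_one_right]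
  have h2 : (q + 1 + 1).choose q = (q + 2).choose 2 := by
    rw [show q + 1 + 1 = q + 2 by ring, Nat.choose_symm_add]
  have h3 : (q + 2 + 1).choose q = (q + 2 + 1).choose 3 := by
    rw [show q + 2 + 1 = q + 3 by ring, Nat.choose_symm_add]
  have h4 : (q + 3 + 1).choose q = (q + 2 + 2).choose 4 := by
    rw [show q + 3 + 1 = q + 4 by ring, show q + 2 + 2 = q + 4 by ring, Nat.choose_symm_add]
  obtain ⟨c2, c3, c4, -⟩ := choose_small_values q
  obtain ⟨d2, -, -, -⟩ := choose_small_values (q + 3)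
  obtain ⟨-, d3, -, -⟩ := choose_small_values (q + 2)
  obtain ⟨-, -, d4, -⟩ := choose_small_values (q + 1)
  have e2 : ((q + 2).choose 2 : ℚ) = (q + 2) * (q + 1) / 2 := by rw [eq_div_iff (by norm_num)]; exact c2
  have e3 : ((q + 2 + 1).choose 3 : ℚ) = (q + 3) * (q + 2) * (q + 1) / 6 := by
    rw [eq_div_iff (by norm_num)]; exact c3
  have e4 : ((q + 2 + 2).choose 4 : ℚ) = (q + 4) * (q + 3) * (q + 2) * (q + 1) / 24 := by
    rw [eq_div_iff (by norm_num)]; exact c4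
  have f2 : ((q + 5).choose 2 : ℚ) = (q + 5) * (q + 4) / 2 := by
    rw [eq_div_iff (by norm_num), show q + 5 = q + 3 + 2 by ring]; push_cast at d2 ⊢; linarith [d2]
  have f3 : ((q + 5).choose 3 : ℚ) = (q + 5) * (q + 4) * (q + 3) / 6 := by
    rw [eq_div_iff (by norm_num), show q + 5 = q + 2 + 2 + 1 by ring]; push_cast at d3 ⊢; linarith [d3]
  have f4 : ((q + 5).choose 4 : ℚ) = (q + 5) * (q + 4) * (q + 3) * (q + 2) / 24 := by
    rw [eq_div_iff (by norm_num), show q + 5 = q + 1 + 2 + 2 by ring]; push_cast at d4 ⊢; linarith [d4]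
  rw [h1, h2, h3, h4]
  push_cast
  rw [e2, e3, e4, f2, f3, f4]
  field_simp
  ring

/-- On the slice `u = 2` the truncated `m̂(q, m; a, 3)` keeps the term `C(3, 2)·C(q+a, a+2)`: `3·C(m+2+a, a+2) ≤ m̂`. -/
lemma mhat_three_ge (m a : ℕ) : 3 * (m + 2 + a).choose (a + 2) ≤ mhat (m + 2) m a 3 := by
  rw [mhat_eq, show m + 2 - m = 2 by omega, show min 3 2 = 2 by rfl]
  simp only [Finset.sum_range_succ, Finset.sum_range_zero, Nat.choose_zero_right, Nat.choose_one_right, add_zero,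
    zero_add, one_mul, show (3 : ℕ).choose 2 = 3 by rfl]
  omega

/-- On the slice `u = 2` the truncated `m̂(q, m; a, 4)` keeps the term `C(4, 2)·C(q+a, a+2)`: `6·C(m+2+a, a+2) ≤ m̂`. -/
lemma mhat_four_ge (m a : ℕ) : 6 * (m + 2 + a).choose (a + 2) ≤ mhat (m + 2) m a 4 := by
  rw [mhat_eq, show m + 2 - m = 2 by omega, show min 4 2 = 2 by rfl]
  simp only [Finset.sum_range_succ, Finset.sum_range_zero, Nat.choose_zero_right, Nat.choose_one_right, add_zero,
    zero_add, one_mul, show (4 : ℕ).choose 2 = 6 by rfl]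
  omega

/-! ### §4 The upper bound on `R̂(m+2, 5, m)` and the negative theorem -/

/-- **`R̂(m+2, 5, m) ≤ 7S₁ + 21S₂ + (35/3)T + (35/6)T`** (`j = 1, 2` untruncated, `j = 3, 4` by `mhat_three_ge` / `mhat_four_ge`). -/
lemma rhat_five_le (m : ℕ) :
    rhat (m + 2) 5 m
      ≤ 7 * ∑ a ∈ range (m + 1), (m.choose a : ℚ) / ((m + 1 + 1 + 1 + a).choose (a + 1) : ℚ)
        + 21 * ∑ a ∈ range (m + 1), (m.choose a : ℚ) / ((m + 2 + 2 + a).choose (a + 2) : ℚ)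
        + 35 / 3 * ∑ a ∈ range (m + 1), (m.choose a : ℚ) / ((m + 2 + a).choose (a + 2) : ℚ)
        + 35 / 6 * ∑ a ∈ range (m + 1), (m.choose a : ℚ) / ((m + 2 + a).choose (a + 2) : ℚ) := by
  unfold rhat
  rw [sum_Ioo_nat, show (5 : ℕ) - (0 + 1) = 1 + 1 + 1 + 1 by rfl, Finset.sum_range_succ _ (1 + 1 + 1),
    Finset.sum_range_succ _ (1 + 1), Finset.sum_range_succ _ 1, Finset.sum_range_one]
  simp only [zero_add, add_zero, show (1 : ℕ) + 1 = 2 by rfl, show (1 : ℕ) + 1 + 1 = 3 by rfl,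
    show (1 : ℕ) + 1 + 1 + 1 = 4 by rfl, show m + 2 + 5 - m = 7 by omega]
  simp only [Nat.choose_one_right]
  have hm1 : ∀ a, mhat (m + 2) m a 1 = (m + 1 + 1 + 1 + a).choose (a + 1) := fun a => by
    rw [show m + 2 = m + 1 + 1 by ring]; exact mhat_two m 1 a
  have hm2 : ∀ a, mhat (m + 2) m a 2 = (m + 2 + 2 + a).choose (a + 2) := fun a => by
    have h := mhat_three' m 0 a
    rw [show m + 0 + 2 = m + 2 by ring, show m + 0 + 2 + 2 + a = m + 2 + 2 + a by ring] at h
    exact h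
  simp only [hm1, hm2]
  push_cast
  have hrw1 : ∑ a ∈ range (m + 1), (m.choose a : ℚ) * 7 / ((m + 1 + 1 + 1 + a).choose (a + 1) : ℚ)
      = 7 * ∑ a ∈ range (m + 1), (m.choose a : ℚ) / ((m + 1 + 1 + 1 + a).choose (a + 1) : ℚ) := by
    rw [Finset.mul_sum]; exact Finset.sum_congr rfl (fun a _ => by ring)
  have hrw2 : ∑ a ∈ range (m + 1), (m.choose a : ℚ) * ((7 : ℕ).choose 2 : ℚ) / ((m + 2 + 2 + a).choose (a + 2) : ℚ)
      = 21 * ∑ a ∈ range (m + 1), (m.choose a : ℚ) / ((m + 2 + 2 + a).choose (a + 2) : ℚ) := by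
    rw [Finset.mul_sum, show (7 : ℕ).choose 2 = 21 by decide]
    exact Finset.sum_congr rfl (fun a _ => by push_cast; ring)
  have h3 : ∑ a ∈ range (m + 1), (m.choose a : ℚ) * ((7 : ℕ).choose 3 : ℚ) / (mhat (m + 2) m a 3 : ℚ)
      ≤ 35 / 3 * ∑ a ∈ range (m + 1), (m.choose a : ℚ) / ((m + 2 + a).choose (a + 2) : ℚ) := by
    rw [Finset.mul_sum, show (7 : ℕ).choose 3 = 35 by decide]
    apply Finset.sum_le_sum
    intro a _
    have hb := mhat_three_ge m a
    have hpos : (0 : ℚ) < (m + 2 + a).choose (a + 2) := by exact_mod_cast Nat.choose_pos (by omega)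
    have hb' : (3 : ℚ) * ((m + 2 + a).choose (a + 2) : ℚ) ≤ (mhat (m + 2) m a 3 : ℚ) := by exact_mod_cast hb
    rw [show 35 / 3 * ((m.choose a : ℚ) / ((m + 2 + a).choose (a + 2) : ℚ))
        = (m.choose a : ℚ) * 35 / (3 * ((m + 2 + a).choose (a + 2) : ℚ)) by field_simp]
    push_cast
    exact div_le_div_of_nonneg_left (by positivity) (by positivity) hb'
  have h4 : ∑ a ∈ range (m + 1), (m.choose a : ℚ) * ((7 : ℕ).choose 4 : ℚ) / (mhat (m + 2) m a 4 : ℚ)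
      ≤ 35 / 6 * ∑ a ∈ range (m + 1), (m.choose a : ℚ) / ((m + 2 + a).choose (a + 2) : ℚ) := by
    rw [Finset.mul_sum, show (7 : ℕ).choose 4 = 35 by decide]
    apply Finset.sum_le_sum
    intro a _
    have hb := mhat_four_ge m a
    have hpos : (0 : ℚ) < (m + 2 + a).choose (a + 2) := by exact_mod_cast Nat.choose_pos (by omega)
    have hb' : (6 : ℚ) * ((m + 2 + a).choose (a + 2) : ℚ) ≤ (mhat (m + 2) m a 4 : ℚ) := by exact_mod_cast hb
    rw [show 35 / 6 * ((m.choose a : ℚ) / ((m + 2 + a).choose (a + 2) : ℚ))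
        = (m.choose a : ℚ) * 35 / (6 * ((m + 2 + a).choose (a + 2) : ℚ)) by field_simp]
    push_cast
    exact div_le_div_of_nonneg_left (by positivity) (by positivity) hb'
  rw [hrw1, hrw2]
  linarith [h3, h4]

/-- **The finish** (`m = t + 1000`, `X ≥ 0`, `X² ≤ 4m`): the bound of `rhat_five_le` in closed form, `(baseN + cN·X)/D`, is below
`Φ(m+7, m+2) = phiN/phiD` — `cN·phiD·X < N1 := phiN·D − baseN·phiD` by `(cN·phiD)²·4m < N1²` (the certificate `Q`, degree 10 in `t`,
11 positive coefficients). -/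
lemma k5_finish (t : ℕ) (X : ℚ) (hX2 : X ^ 2 ≤ 4 * ((t : ℚ) + 1000)) :
    7 * ((((t : ℚ) + 1000) + 1 - (X * (((t : ℚ) + 1000) + 2) / (2 * ((t : ℚ) + 1000) + 1) - 1 - (((t : ℚ) + 1000) + 2) / (2 * (((t : ℚ) + 1000) + 1)))) / (2 * ((t : ℚ) + 1000) + 3)) +
          21 * ((1 + 2 * (X * (((t : ℚ) + 1000) + 2) / (2 * ((t : ℚ) + 1000) + 1) - 1 - (((t : ℚ) + 1000) + 2) / (2 * (((t : ℚ) + 1000) + 1)))) / (2 * (2 * ((t : ℚ) + 1000) + 3))) +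
        35 / 3 * (1 / (2 * ((t : ℚ) + 1000) + 2) + X / (2 * (2 * ((t : ℚ) + 1000) + 1))) +
      35 / 6 * (1 / (2 * ((t : ℚ) + 1000) + 2) + X / (2 * (2 * ((t : ℚ) + 1000) + 1))) <
    4 * (((t : ℚ) + 1000) + 2 + 5) * (((t : ℚ) + 1000) + 2 + 3) / ((((t : ℚ) + 1000) + 2 + 1) * (((t : ℚ) + 1000) + 2 + 2)) := by
  -- LHS = (baseN + cN·X)/D, RHS = phiN/phiD
  have hlin : 7 * ((((t : ℚ) + 1000) + 1 - (X * (((t : ℚ) + 1000) + 2) / (2 * ((t : ℚ) + 1000) + 1) - 1 - (((t : ℚ) + 1000) + 2) / (2 * (((t : ℚ) + 1000) + 1)))) / (2 * ((t : ℚ) + 1000) + 3)) +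
          21 * ((1 + 2 * (X * (((t : ℚ) + 1000) + 2) / (2 * ((t : ℚ) + 1000) + 1) - 1 - (((t : ℚ) + 1000) + 2) / (2 * (((t : ℚ) + 1000) + 1)))) / (2 * (2 * ((t : ℚ) + 1000) + 3))) +
        35 / 3 * (1 / (2 * ((t : ℚ) + 1000) + 2) + X / (2 * (2 * ((t : ℚ) + 1000) + 1))) +
      35 / 6 * (1 / (2 * ((t : ℚ) + 1000) + 2) + X / (2 * (2 * ((t : ℚ) + 1000) + 1)))
      = (((56196210063 : ℚ) + (168392210 : ℚ) * (t : ℚ) + (168196 : ℚ) * (t : ℚ) ^ 2 + (56 : ℚ) * (t : ℚ) ^ 3) + ((126343217 : ℚ) + (252343 : ℚ) * (t : ℚ) + (126 : ℚ) * (t : ℚ) ^ 2) * X) / ((16048044012 : ℚ) + (48096044 : ℚ) * (t : ℚ) + (48048 : ℚ) * (t : ℚ) ^ 2 + (16 : ℚ) * (t : ℚ) ^ 3) := by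
    field_simp
    ring
  have hphi : 4 * (((t : ℚ) + 1000) + 2 + 5) * (((t : ℚ) + 1000) + 2 + 3) / ((((t : ℚ) + 1000) + 2 + 1) * (((t : ℚ) + 1000) + 2 + 2))
      = ((4048140 : ℚ) + (8048 : ℚ) * (t : ℚ) + (4 : ℚ) * (t : ℚ) ^ 2) / ((1007012 : ℚ) + (2007 : ℚ) * (t : ℚ) + (1 : ℚ) * (t : ℚ) ^ 2) := by
    field_simp
    ring
  rw [hlin, hphi, div_lt_div_iff₀ (by positivity) (by positivity)]
  -- need: (baseN + cN X)·phiD < phiN·D, i.e. cN·phiD·X < N1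
  have hN1 : (0 : ℚ) < (8374470998775924 : ℚ) + (41495407993775 : ℚ) * (t : ℚ) + (82239402995 : ℚ) * (t : ℚ) ^ 2 + (81490466 : ℚ) * (t : ℚ) ^ 3 + (40372 : ℚ) * (t : ℚ) ^ 4 + (8 : ℚ) * (t : ℚ) ^ 5 := by positivity
  have hQ : (0 : ℚ) < (5382752688971677307430918789776 : ℚ) + (113518345316782172197239982936 : ℚ) * (t : ℚ) + (778359305333167744653167065 : ℚ) * (t : ℚ) ^ 2 + (2786152731028282973944358 : ℚ) * (t : ℚ) ^ 3 + (6114171473003089016181 : ℚ) * (t : ℚ) ^ 4 + (8817084752887919292 : ℚ) * (t : ℚ) ^ 5 + (8575979327291756 : ℚ) * (t : ℚ) ^ 6 + (5599664069084 : ℚ) * (t : ℚ) ^ 7 + (2360975040 : ℚ) * (t : ℚ) ^ 8 + (582448 : ℚ) * (t : ℚ) ^ 9 + (64 : ℚ) * (t : ℚ) ^ 10 := by positivity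
  have hkey : (((126343217 : ℚ) + (252343 : ℚ) * (t : ℚ) + (126 : ℚ) * (t : ℚ) ^ 2) * ((1007012 : ℚ) + (2007 : ℚ) * (t : ℚ) + (1 : ℚ) * (t : ℚ) ^ 2) * X) ^ 2 < ((8374470998775924 : ℚ) + (41495407993775 : ℚ) * (t : ℚ) + (82239402995 : ℚ) * (t : ℚ) ^ 2 + (81490466 : ℚ) * (t : ℚ) ^ 3 + (40372 : ℚ) * (t : ℚ) ^ 4 + (8 : ℚ) * (t : ℚ) ^ 5) ^ 2 := by
    have hc : (0 : ℚ) ≤ ((126343217 : ℚ) + (252343 : ℚ) * (t : ℚ) + (126 : ℚ) * (t : ℚ) ^ 2) * ((1007012 : ℚ) + (2007 : ℚ) * (t : ℚ) + (1 : ℚ) * (t : ℚ) ^ 2) := by positivity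
    calc (((126343217 : ℚ) + (252343 : ℚ) * (t : ℚ) + (126 : ℚ) * (t : ℚ) ^ 2) * ((1007012 : ℚ) + (2007 : ℚ) * (t : ℚ) + (1 : ℚ) * (t : ℚ) ^ 2) * X) ^ 2 = (((126343217 : ℚ) + (252343 : ℚ) * (t : ℚ) + (126 : ℚ) * (t : ℚ) ^ 2) * ((1007012 : ℚ) + (2007 : ℚ) * (t : ℚ) + (1 : ℚ) * (t : ℚ) ^ 2)) ^ 2 * X ^ 2 := by ring
      _ ≤ (((126343217 : ℚ) + (252343 : ℚ) * (t : ℚ) + (126 : ℚ) * (t : ℚ) ^ 2) * ((1007012 : ℚ) + (2007 : ℚ) * (t : ℚ) + (1 : ℚ) * (t : ℚ) ^ 2)) ^ 2 * (4 * ((t : ℚ) + 1000)) := by gcongr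
      _ < ((8374470998775924 : ℚ) + (41495407993775 : ℚ) * (t : ℚ) + (82239402995 : ℚ) * (t : ℚ) ^ 2 + (81490466 : ℚ) * (t : ℚ) ^ 3 + (40372 : ℚ) * (t : ℚ) ^ 4 + (8 : ℚ) * (t : ℚ) ^ 5) ^ 2 := by nlinarith [hQ]
  have hlt : ((126343217 : ℚ) + (252343 : ℚ) * (t : ℚ) + (126 : ℚ) * (t : ℚ) ^ 2) * ((1007012 : ℚ) + (2007 : ℚ) * (t : ℚ) + (1 : ℚ) * (t : ℚ) ^ 2) * X < (8374470998775924 : ℚ) + (41495407993775 : ℚ) * (t : ℚ) + (82239402995 : ℚ) * (t : ℚ) ^ 2 + (81490466 : ℚ) * (t : ℚ) ^ 3 + (40372 : ℚ) * (t : ℚ) ^ 4 + (8 : ℚ) * (t : ℚ) ^ 5 := by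
    have := abs_lt_of_sq_lt_sq' hkey hN1.le
    exact this.2
  nlinarith [hlt]

/-- The closed forms at `u = 2` and `u = 0`, assembled: with `X = 4^m/C(2m, m)` the bound of `rhat_five_le` is linear in `X`. -/
theorem rhat_five_lt_phiK_aux (m : ℕ) (hm : 1000 ≤ m) :
    7 * ∑ a ∈ range (m + 1), (m.choose a : ℚ) / ((m + 1 + 1 + 1 + a).choose (a + 1) : ℚ)
        + 21 * ∑ a ∈ range (m + 1), (m.choose a : ℚ) / ((m + 2 + 2 + a).choose (a + 2) : ℚ)
        + 35 / 3 * ∑ a ∈ range (m + 1), (m.choose a : ℚ) / ((m + 2 + a).choose (a + 2) : ℚ)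
        + 35 / 6 * ∑ a ∈ range (m + 1), (m.choose a : ℚ) / ((m + 2 + a).choose (a + 2) : ℚ)
      < phiK (m + 2 + 5) (m + 2) := by
  rw [phiK_five, cellTwo_sum_eq m 1, slice_two_S2_eq m (by omega), slice_T_eq m (by omega)]
  push_cast
  set C := ((m + 1 + 1 + m).choose m : ℚ) with hC
  set P := ∑ i ∈ range m, ((m + 1 + 1 + m).choose i : ℚ) with hPdef
  set C0 := ((2 * m).choose m : ℚ) with hC0
  set X := (4 : ℚ) ^ m / C0 with hXdef
  have hCpos : (0 : ℚ) < C := by rw [hC]; exact_mod_cast Nat.choose_pos (by omega)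
  have hC0pos : (0 : ℚ) < C0 := by rw [hC0]; exact_mod_cast Nat.choose_pos (by omega)
  -- ρ = P/C through the half row of `2m+2`, and `C = C(2m+2, m)` against `C0 = C(2m, m)`
  obtain ⟨r1, r2⟩ := choose_row_two_ratios m
  have hhalf := sum_range_choose_half_two m
  have hB : ((2 * m + 2).choose (m + 1) : ℚ) * (m + 1) = C * (m + 2) := by
    rw [hC, show m + 1 + 1 + m = 2 * m + 2 by ring]; exact_mod_cast r1
  have h2 : ((2 * m + 2).choose (m + 2) : ℚ) = C := by
    rw [hC, show m + 1 + 1 + m = 2 * m + 2 by ring]; exact_mod_cast r2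
  have h0 : ((2 * m + 2).choose m : ℚ) = C := by rw [hC, show m + 1 + 1 + m = 2 * m + 2 by ring]
  have hh : ((2 * ∑ i ∈ range m, (2 * m + 2).choose i + (2 * m + 2).choose m + (2 * m + 2).choose (m + 1)
      + (2 * m + 2).choose (m + 2) : ℕ) : ℚ) = ((4 ^ (m + 1) : ℕ) : ℚ) := by rw [hhalf]
  push_cast at hh
  rw [h0, h2] at hh
  have hPP : P = ∑ i ∈ range m, ((2 * m + 2).choose i : ℚ) := by
    rw [hPdef, show m + 1 + 1 + m = 2 * m + 2 by ring]
  have hCC0 : C * ((m : ℚ) + 2) * ((m : ℚ) + 1) = C0 * (2 * (m : ℚ) + 1) * (2 * (m : ℚ) + 2) := by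
    have ha := Nat.choose_mul_succ_eq (2 * m) m
    rw [show 2 * m + 1 - m = m + 1 by omega] at ha
    have hb' := Nat.choose_mul_succ_eq (2 * m + 1) m
    rw [show 2 * m + 1 + 1 - m = m + 2 by omega, show 2 * m + 1 + 1 = 2 * m + 2 by ring] at hb'
    have ha' : C0 * (2 * (m : ℚ) + 1) = ((2 * m + 1).choose m : ℚ) * (m + 1) := by
      rw [hC0]; exact_mod_cast ha
    have hb'' : ((2 * m + 1).choose m : ℚ) * (2 * m + 2) = C * (m + 2) := by
      rw [hC, show m + 1 + 1 + m = 2 * m + 2 by ring]; exact_mod_cast hb'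
    nlinarith [ha', hb'']
  have hX : (4 : ℚ) ^ m = X * C0 := by rw [hXdef]; field_simp
  have hrho : P / C = X * ((m : ℚ) + 2) / (2 * (m : ℚ) + 1) - 1 - ((m : ℚ) + 2) / (2 * ((m : ℚ) + 1)) := by
    rw [hPP, div_eq_iff hCpos.ne']
    have hB' : ((2 * m + 2).choose (m + 1) : ℚ) = C * (m + 2) / (m + 1) := by
      rw [eq_div_iff (by positivity)]; exact hB
    rw [hB'] at hh
    have hC' : C = C0 * (2 * (m : ℚ) + 1) * (2 * (m : ℚ) + 2) / (((m : ℚ) + 2) * ((m : ℚ) + 1)) := by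
      rw [eq_div_iff (by positivity)]; linear_combination hCC0
    have hsum : ∑ i ∈ range m, ((2 * m + 2).choose i : ℚ)
        = ((4 : ℚ) ^ (m + 1) - C - C * (m + 2) / (m + 1) - C) / 2 := by linarith [hh]
    rw [hsum, pow_succ, hX, hC']
    field_simp
    ring
  have e1 : (((m : ℚ) + 1) * C - 1 * P) / (C * ((m : ℚ) + 1 + 1 + m + 1))
      = (((m : ℚ) + 1) - P / C) / (2 * (m : ℚ) + 3) := by field_simp; ring
  have e2 : (C + 2 * P) / (2 * C * (2 * (m : ℚ) + 3)) = (1 + 2 * (P / C)) / (2 * (2 * (m : ℚ) + 3)) := by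
    field_simp
  rw [e1, e2, hrho]
  -- Wallis upper bound: X² ≤ 4m
  have hW := centralBinom_sq_mul_ge m (by omega)
  rw [Nat.centralBinom_eq_two_mul_choose] at hW
  have hX2 : X ^ 2 ≤ 4 * (m : ℚ) := by
    have h16 : (16 : ℚ) ^ m = ((4 : ℚ) ^ m) ^ 2 := by rw [← pow_mul, mul_comm, pow_mul]; norm_num
    have h' : ((16 ^ m : ℕ) : ℚ) ≤ (((2 * m).choose m ^ 2 * (4 * m) : ℕ) : ℚ) := by exact_mod_cast hW
    push_cast at h'
    rw [h16, hX] at h'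
    have : (X * C0) ^ 2 = X ^ 2 * C0 ^ 2 := by ring
    rw [this] at h'
    have hC0sq : (0 : ℚ) < C0 ^ 2 := by positivity
    nlinarith [h', hC0sq]
  obtain ⟨t, rfl⟩ : ∃ t, m = t + 1000 := ⟨m - 1000, by omega⟩
  push_cast at hX2 ⊢
  exact k5_finish t X hX2

/-- **(R̂) FAILS at `m = q − 2` on the cell `(q+5, q)` for every `q ≥ 1002`**: `R̂(m+2, 5, m) < Φ(m+7, m+2)` for `m ≥ 1000`. -/
theorem rhat_five_lt_phiK (m : ℕ) (hm : 1000 ≤ m) : rhat (m + 2) 5 m < phiK (m + 2 + 5) (m + 2) :=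
  (rhat_five_le m).trans_lt (rhat_five_lt_phiK_aux m hm)

/-- **Rule Q is exactly the `k ≤ 4` mechanism**: `RhatCell q 5` is FALSE for every `q ≥ 1002` (the member slice `u = 2`).
With `rhatCell_two`, `rhatCell_three`, `rhatCell_four`, (R̂) holds on every cell of exactly the families `k ≤ 4`. -/
theorem not_rhatCell_five (q : ℕ) (hq : 1002 ≤ q) : ¬ RhatCell q 5 := by
  intro h
  obtain ⟨m, rfl⟩ : ∃ m, q = m + 2 := ⟨q - 2, by omega⟩
  have h1 := h m (by omega)
  exact absurd h1 (not_le.mpr (rhat_five_lt_phiK m (by omega)))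

end PercRepro
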